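import Summits.QuantumFields.YangMills.Theorems.PoincareLipschitzMedianCentringLocalTail
import Summits.QuantumFields.YangMills.Theorems.FibreConvexityTailHistoryTailOfTwoSided
import HarnessLib

/-!
# Route `PoincareLipschitz` ∕ LINE 27 «MedianCentring» — helper T-3: THE DOORS «`TwoSidedTailL ∧ TowerTailL` AND `HistoryTailL` MODULO
# {K1 `MesoscopicConcentrationL`, K2 `BlockLipschitzL`, (Q) the 3/4-quantile}» (crux of record `UnitScaleTilt.HistoryTailL`, stmt-QuantumFields-19936;
# LINE 27 registered on stmt-QuantumFields-23133, skeleton `Cruxes/HistoryTailL/Lines/median_centring.lean`)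

The registered skeleton's kernel-checked compositions `TwoSided_of` ∕ `HistoryTailL_of` with the stub (T) REPLACED BY THE THEOREM
`PoincareLipschitz.MedianCentring.local_tail_median` (helper T-2): from the concentration crux K1, the block-Lipschitz crux K2 and the quantile bound (Q)
alone — NO first-moment hypothesis `MeanDeviationL`, no stub — both events of route `FibreConvexityTail` (sub-events of the local window event; `bmin = 0`,
`A = 0`, exactly as in the landed `twoSidedOfConcentration_proof`) and then `UnitScaleTilt.HistoryTailL` BY NAME through the landed
`fibreConvexityTail_historyTailOfTwoSided_proof`.  A door, not a display flip: (Q) is the OPEN registered stub `stub_quantileDeviation` (XL in substance),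
K1 and K2 are OPEN cruxes (stmt-23532 ∕ stmt-23533).

Width seat ym3-torus-px10 g6 (cell ym3-torus, WIDTH COPY «width 10»), `--supports stmt-QuantumFields-19936`.  Nothing of (Q), K1, K2, `HistoryTailL`,
`MeanDeviationL` or the rung is proved (R3 = YM₃ on T³; NOT d = 4, NOT infinite volume, NOT a mass gap, NOT Clay); the Yang–Mills mass gap is NOT proved.
-/

set_option autoImplicit false

namespace Summit.QuantumFields.YangMills.Theorems.PoincareLipschitz.MedianCentring

open MeasureTheory
open scoped BigOperators
open Literature.MathematicalPhysics.QuantumFieldTheory.Balaban1983to89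
open Literature.MathematicalPhysics.QuantumFieldTheory.Balaban1983to89.T3ContinuumYM3Torus
open Literature.MathematicalPhysics.QuantumFieldTheory.Balaban1983to89.T3UnitScaleTilt
open Literature.MathematicalPhysics.QuantumFieldTheory.Balaban1983to89.T3UnitLawDensityEML (ℰp measurableE_ℰp)

/-- **DOOR 1: `FibreConvexityTail.TwoSidedTailL ∧ FibreConvexityTail.TowerTailL` from K1, K2 and the 3/4-quantile (Q)** — the landed assembly of
`twoSidedOfConcentration_proof` with `local_tail_median` for `local_tail`; no first-moment hypothesis.  [cite: Balaban1985UV3, (7) p.257 and (71) p.273] -/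
theorem twoSided_of_quantile
    (hQ : ∀ (L : ℕ) (b₀ p₀ : ℝ), 0 < b₀ → 2 < p₀ → ∃ γ₁ : ℝ, 0 < γ₁ ∧ γ₁ ≤ 1 ∧ ∀ (F : T3Family) (γ : ℝ), F.L = L → 0 < γ → γ ≤ γ₁ →
            ∀ (K j : ℕ), 1 ≤ j → j + 2 ≤ K → ∀ a : Plaq (F.P K) j,
              3 / 4 ≤ (gibbsK F ℰp γ K).real {U : GaugeField (F.P K) 0 (Matrix.specialUnitaryGroup (Fin 2) ℂ) | GaugeGroup.dist1 (GaugeField.plaqHol (Averaging.iter (fun i' => BlockAveraging.blockAvg (P := F.P K) (j := i') ℰp) j U) a) ≤ θBal F.L γ b₀ p₀ (K - j) / 8})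
    (hC : Summit.QuantumFields.YangMills.Theses.PoincareLipschitz.MesoscopicConcentrationL)
    (hLip : Summit.QuantumFields.YangMills.Theses.PoincareLipschitz.BlockLipschitzL) :
    Summit.QuantumFields.YangMills.Theses.FibreConvexityTail.TwoSidedTailL ∧ Summit.QuantumFields.YangMills.Theses.FibreConvexityTail.TowerTailL := by
  refine ⟨fun L => ⟨0, fun b₀ p₀ _ hb₀ hp₀ => ?_⟩, fun L => ⟨0, fun b₀ p₀ _ hb₀ hp₀ => ?_⟩⟩
  · obtain ⟨γ₁, C, c, hγ₁, hγ₁1, hC0, hc, H⟩ := local_tail_median hC hLip hQ L hb₀ hp₀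
    refine ⟨γ₁, hγ₁, hγ₁1, fun F γ hFL hγ hle => ⟨C, 0, c, hC0, hc, fun K j hj hjK a => ?_⟩⟩
    haveI := isProbabilityMeasure_gibbsK F ℰp hγ.le K
    have hsub : ({U : GaugeField (F.P K) 0 (Matrix.specialUnitaryGroup (Fin 2) ℂ) | θBal F.L γ b₀ p₀ (K - j) ≤ GaugeGroup.dist1 (GaugeField.plaqHol (Averaging.iter (fun i' => BlockAveraging.blockAvg (P := F.P K) (j := i') ℰp) j U) a)} ∩
          {U : GaugeField (F.P K) 0 (Matrix.specialUnitaryGroup (Fin 2) ℂ) | ∀ i, i < j → PlaqSmall (θBal F.L γ b₀ p₀ (K - i)) (Averaging.iter (fun i' => BlockAveraging.blockAvg (P := F.P K) (j := i') ℰp) i U)} ∩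
          {U : GaugeField (F.P K) 0 (Matrix.specialUnitaryGroup (Fin 2) ℂ) | PlaqSmall (θBal F.L γ b₀ p₀ (K - (j + 2))) (Averaging.iter (fun i' => BlockAveraging.blockAvg (P := F.P K) (j := i') ℰp) (j + 2) U)}) ⊆
        ({U : GaugeField (F.P K) 0 (Matrix.specialUnitaryGroup (Fin 2) ℂ) | θBal F.L γ b₀ p₀ (K - j) ≤ GaugeGroup.dist1 (GaugeField.plaqHol (Averaging.iter (fun i' => BlockAveraging.blockAvg (P := F.P K) (j := i') ℰp) j U) a)} ∩ {U : GaugeField (F.P K) 0 (Matrix.specialUnitaryGroup (Fin 2) ℂ) | (∀ (i : ℕ) (q : Plaq (F.P K) i), i < j → Site.tdist (fun k => ((((q.src k).val * F.L ^ i : ℕ)) : ZMod ((F.P K).sitesPerDir 0))) (fun k => ((((a.src k).val * F.L ^ j : ℕ)) : ZMod ((F.P K).sitesPerDir 0))) + 64 * F.L ^ i ≤ 64 * F.L ^ j → GaugeGroup.dist1 (GaugeField.plaqHol (Averaging.iter (fun i' => BlockAveraging.blockAvg (P := F.P K) (j := i') ℰp) i U) q) < θBal F.L γ b₀ p₀ (K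 - i))}) := by
      rintro U ⟨⟨hU1, hU2⟩, -⟩
      exact ⟨hU1, fun i q hi _ => hU2 i hi q⟩
    calc (gibbsK F ℰp γ K).real ({U : GaugeField (F.P K) 0 (Matrix.specialUnitaryGroup (Fin 2) ℂ) | θBal F.L γ b₀ p₀ (K - j) ≤ GaugeGroup.dist1 (GaugeField.plaqHol (Averaging.iter (fun i' => BlockAveraging.blockAvg (P := F.P K) (j := i') ℰp) j U) a)} ∩
          {U : GaugeField (F.P K) 0 (Matrix.specialUnitaryGroup (Fin 2) ℂ) | ∀ i, i < j → PlaqSmall (θBal F.L γ b₀ p₀ (K - i)) (Averaging.iter (fun i' => BlockAveraging.blockAvg (P := F.P K) (j := i') ℰp) i U)} ∩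
          {U : GaugeField (F.P K) 0 (Matrix.specialUnitaryGroup (Fin 2) ℂ) | PlaqSmall (θBal F.L γ b₀ p₀ (K - (j + 2))) (Averaging.iter (fun i' => BlockAveraging.blockAvg (P := F.P K) (j := i') ℰp) (j + 2) U)})
        ≤ (gibbsK F ℰp γ K).real ({U : GaugeField (F.P K) 0 (Matrix.specialUnitaryGroup (Fin 2) ℂ) | θBal F.L γ b₀ p₀ (K - j) ≤ GaugeGroup.dist1 (GaugeField.plaqHol (Averaging.iter (fun i' => BlockAveraging.blockAvg (P := F.P K) (j := i') ℰp) j U) a)} ∩ {U : GaugeField (F.P K) 0 (Matrix.specialUnitaryGroup (Fin 2) ℂ) | (∀ (i : ℕ) (q : Plaq (F.P K) i), i < j → Site.tdist (fun k => ((((q.src k).val * F.L ^ i : ℕ)) : ZMod ((F.P K).sitesPerDir 0))) (fun k => ((((a.src k).val * F.L ^ j : ℕ)) : ZMod ((F.P K).sitesPerDir 0))) + 64 * F.L ^ i ≤ 64 * F.L ^ j → GaugeGroup.dist1 (GaugeField.plaqHol (Averaging.iter (fun i' => BlockAveraging.blockAvg (P := F.P K) (j := i') ℰp) i U) q) < θBal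 F.L γ b₀ p₀ (K - i))}) :=
          measureReal_mono hsub (measure_ne_top _ _)
      _ ≤ C * Real.exp (-(c * B10.pFun b₀ p₀ (Real.sqrt (γ * ((F.L : ℝ)⁻¹) ^ (K - j))) ^ 2)) := H F γ hFL hγ hle K j hj hjK a
      _ = C * (F.scheme ℰp γ).β (K - j) ^ 0 * Real.exp (-(c * B10.pFun b₀ p₀ (Real.sqrt (γ * ((F.L : ℝ)⁻¹) ^ (K - j))) ^ 2)) := by
          rw [pow_zero, mul_one]
  · obtain ⟨γ₁, C, c, hγ₁, hγ₁1, hC0, hc, H⟩ := local_tail_median hC hLip hQ L hb₀ hp₀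
    refine ⟨γ₁, hγ₁, hγ₁1, fun F γ hFL hγ hle => ⟨C, 0, c, hC0, hc, fun K j hj hjK a => ?_⟩⟩
    haveI := isProbabilityMeasure_gibbsK F ℰp hγ.le K
    have hsub : ({U : GaugeField (F.P K) 0 (Matrix.specialUnitaryGroup (Fin 2) ℂ) | θBal F.L γ b₀ p₀ (K - j) ≤ GaugeGroup.dist1 (GaugeField.plaqHol (Averaging.iter (fun i' => BlockAveraging.blockAvg (P := F.P K) (j := i') ℰp) j U) a)} ∩
          {U : GaugeField (F.P K) 0 (Matrix.specialUnitaryGroup (Fin 2) ℂ) | ∀ i, i < j → PlaqSmall (θBal F.L γ b₀ p₀ (K - i)) (Averaging.iter (fun i' => BlockAveraging.blockAvg (P := F.P K) (j := i') ℰp) i U)} ∩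
          {U : GaugeField (F.P K) 0 (Matrix.specialUnitaryGroup (Fin 2) ℂ) | ¬ PlaqSmall (θBal F.L γ b₀ p₀ (K - (j + 2))) (Averaging.iter (fun i' => BlockAveraging.blockAvg (P := F.P K) (j := i') ℰp) (j + 2) U)}) ⊆
        ({U : GaugeField (F.P K) 0 (Matrix.specialUnitaryGroup (Fin 2) ℂ) | θBal F.L γ b₀ p₀ (K - j) ≤ GaugeGroup.dist1 (GaugeField.plaqHol (Averaging.iter (fun i' => BlockAveraging.blockAvg (P := F.P K) (j := i') ℰp) j U) a)} ∩ {U : GaugeField (F.P K) 0 (Matrix.specialUnitaryGroup (Fin 2) ℂ) | (∀ (i : ℕ) (q : Plaq (F.P K) i), i < j → Site.tdist (fun k => ((((q.src k).val * F.L ^ i : ℕ)) : ZMod ((F.P K).sitesPerDir 0))) (fun k => ((((a.src k).val * F.L ^ j : ℕ)) : ZMod ((F.P K).sitesPerDir 0))) + 64 * F.L ^ i ≤ 64 * F.L ^ j → GaugeGroup.dist1 (GaugeField.plaqHol (Averaging.iter (fun i' => BlockAveraging.blockAvg (P := F.P K) (j := i') ℰp) i U) q) < θBal F.L γ b₀ p₀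 (K - i))}) := by
      rintro U ⟨⟨hU1, hU2⟩, -⟩
      exact ⟨hU1, fun i q hi _ => hU2 i hi q⟩
    calc (gibbsK F ℰp γ K).real ({U : GaugeField (F.P K) 0 (Matrix.specialUnitaryGroup (Fin 2) ℂ) | θBal F.L γ b₀ p₀ (K - j) ≤ GaugeGroup.dist1 (GaugeField.plaqHol (Averaging.iter (fun i' => BlockAveraging.blockAvg (P := F.P K) (j := i') ℰp) j U) a)} ∩
          {U : GaugeField (F.P K) 0 (Matrix.specialUnitaryGroup (Fin 2) ℂ) | ∀ i, i < j → PlaqSmall (θBal F.L γ b₀ p₀ (K - i)) (Averaging.iter (fun i' => BlockAveraging.blockAvg (P := F.P K) (j := i') ℰp) i U)} ∩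
          {U : GaugeField (F.P K) 0 (Matrix.specialUnitaryGroup (Fin 2) ℂ) | ¬ PlaqSmall (θBal F.L γ b₀ p₀ (K - (j + 2))) (Averaging.iter (fun i' => BlockAveraging.blockAvg (P := F.P K) (j := i') ℰp) (j + 2) U)})
        ≤ (gibbsK F ℰp γ K).real ({U : GaugeField (F.P K) 0 (Matrix.specialUnitaryGroup (Fin 2) ℂ) | θBal F.L γ b₀ p₀ (K - j) ≤ GaugeGroup.dist1 (GaugeField.plaqHol (Averaging.iter (fun i' => BlockAveraging.blockAvg (P := F.P K) (j := i') ℰp) j U) a)} ∩ {U : GaugeField (F.P K) 0 (Matrix.specialUnitaryGroup (Fin 2) ℂ) | (∀ (i : ℕ) (q : Plaq (F.P K) i), i < j → Site.tdist (fun k => ((((q.src k).val * F.L ^ i : ℕ)) : ZMod ((F.P K).sitesPerDir 0))) (fun k => ((((a.src k).val * F.L ^ j : ℕ)) : ZMod ((F.P K).sitesPerDir 0))) + 64 * F.L ^ i ≤ 64 * F.L ^ j → GaugeGroup.dist1 (GaugeField.plaqHol (Averaging.iter (fun i' => BlockAveraging.blockAvg (P := F.P K) (j := i') ℰp) i U)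 q) < θBal F.L γ b₀ p₀ (K - i))}) :=
          measureReal_mono hsub (measure_ne_top _ _)
      _ ≤ C * Real.exp (-(c * B10.pFun b₀ p₀ (Real.sqrt (γ * ((F.L : ℝ)⁻¹) ^ (K - j))) ^ 2)) := H F γ hFL hγ hle K j hj hjK a
      _ = C * (F.scheme ℰp γ).β (K - j) ^ 0 * Real.exp (-(c * B10.pFun b₀ p₀ (Real.sqrt (γ * ((F.L : ℝ)⁻¹) ^ (K - j))) ^ 2)) := by
          rw [pow_zero, mul_one]

/-- **DOOR 2 — «`HistoryTailL` MODULO {K1, K2, QUANTILE}»**: the crux of record `UnitScaleTilt.HistoryTailL` (stmt-QuantumFields-19936) BY NAME from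
`MesoscopicConcentrationL`, `BlockLipschitzL` and the 3/4-quantile bound (Q), through the landed `fibreConvexityTail_historyTailOfTwoSided_proof`;
no `MeanDeviationL`.  [cite: Balaban1985UV3, (7) p.257 and (71) p.273; Ledoux2001, Prop. 1.3] -/
theorem historyTailL_of_quantile
    (hC : Summit.QuantumFields.YangMills.Theses.PoincareLipschitz.MesoscopicConcentrationL)
    (hLip : Summit.QuantumFields.YangMills.Theses.PoincareLipschitz.BlockLipschitzL)
    (hQ : ∀ (L : ℕ) (b₀ p₀ : ℝ), 0 < b₀ → 2 < p₀ → ∃ γ₁ : ℝ, 0 < γ₁ ∧ γ₁ ≤ 1 ∧ ∀ (F : T3Family) (γ : ℝ), F.L = L → 0 < γ → γ ≤ γ₁ →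
            ∀ (K j : ℕ), 1 ≤ j → j + 2 ≤ K → ∀ a : Plaq (F.P K) j,
              3 / 4 ≤ (gibbsK F ℰp γ K).real {U : GaugeField (F.P K) 0 (Matrix.specialUnitaryGroup (Fin 2) ℂ) | GaugeGroup.dist1 (GaugeField.plaqHol (Averaging.iter (fun i' => BlockAveraging.blockAvg (P := F.P K) (j := i') ℰp) j U) a) ≤ θBal F.L γ b₀ p₀ (K - j) / 8}) :
    Summit.QuantumFields.YangMills.Theses.UnitScaleTilt.HistoryTailL :=
  Summit.QuantumFields.YangMills.Theorems.fibreConvexityTail_historyTailOfTwoSided_proof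
    (twoSided_of_quantile hQ hC hLip).1 (twoSided_of_quantile hQ hC hLip).2

end Summit.QuantumFields.YangMills.Theorems.PoincareLipschitz.MedianCentring
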